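import Literature.MathematicalPhysics.QuantumFieldTheory.Balaban1983to89.B9Thm31SiteGsqDecayReg335Y
import Literature.MathematicalPhysics.QuantumFieldTheory.Balaban1983to89.B9Eq335PlaquetteAtLettersY
import Literature.MathematicalPhysics.QuantumFieldTheory.Balaban1983to89.Node00.OpsYGauge
import Literature.MathematicalPhysics.QuantumFieldTheory.Balaban1983to89.B9Eq3104CommutatorGradFormDD

/-!
# `Balaban1983to89.B9Thm31SiteCurvatureCommutatorsY` — T. Bałaban, *Propagators for lattice gauge theories in a background field*, Commun. Math. Phys. **99** (1985)
# 389–434 [Balaban1985BackgroundPropagators] (3.3)–(3.8) pp. 390–392, (3.35) p. 396, (3.117)–(3.120) p. 419: **THE CURVATURE COMMUTATORS OF def-Y's COVARIANT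
# DIFFERENCES — `[∇_μ, ∇_ν]` AND `[∇*_ν, ∇_μ]` ARE PLAQUETTE DEFECTS, WITH THEIR `HS` SIZES `≤ 4|U(∂p) − 1|²` AT A `G`-VALUED BACKGROUND, AND THE BRIDGE FROM
# def-Y's HOLONOMY `holY` TO THE BOX-CHART PLAQUETTE VARIABLES** (file 26 of width seat `pub-ymgap-dag-n06-w1`'s set; the algebra under the `L²` Bochner–Weitzenböck
# inequality of file 27 `…B9Thm31SiteBochnerY`, i.e. under the second-order members of (3.46) for `G′_□` — dag-n06-k's `L2SecondLegs37.l5`, `FactorsL2Second37`)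

statement-level skeleton of published theorems with citation tags; proofs where landed; nothing here is a claim about the Yang–Mills mass gap

THE PRINT.  p. 419, (3.117)–(3.120): the identities by which `Δ` is commuted past `D`, with remainders given by plaquette variables («small … if U satisfies the condition
(3.36)»); (3.35) p. 396: the plaquette window of the class.  What is typed here is the [folklore] lattice algebra behind them in def-Y's letters (`Node00.OpsYOfLetters.cdS ∕
cdsS ∕ UboxY ∕ shiftY`, `B9Eq39Adjoint.R ∕ plaqU`, `Node00.OpsYDeltaA.holY`): the NE9 team's `B9Eq3117LaplaceDerivCommutator` ∕ `…CommutatorBound` do the `[D*D, D_ν]`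
commutator on their own carrier (`TSite`, generic transporters) in SUP norm and need the current window `‖J‖ ≤ α` ((3.36)); the `L²` route of file 27 keeps the outer `∇*`
on the other side of the pairing, so only the TWO-TERM commutators below and the plaquette window (3.35) are needed — no `J`.

WHAT IS PROVED (sorry-free; 0 `def`; every `U`, then `G`-valued `U` with `G ≤ U(N)` for the sizes).
* §1 `shiftY_shiftY_comm` (the box-chart shifts commute; the mixed form is lit-balaban's `B9Eq3104CommutatorGradFormDD.shiftY_symm_shiftY_comm`, imported).
* §2 ★ `cdS_cdS_sub_apply`: `(∇_μ∇_νw − ∇_ν∇_μw)(z) = R(U_μ(z)U_ν(z+e_μ))w(z+e_μ+e_ν) − R(U_ν(z)U_μ(z+e_ν))w(z+e_μ+e_ν)`; ★ `cdsS_cdS_sub_apply`: the `[∇*_ν, ∇_μ]` twin at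
  `x = z − e_ν`; `paths_eq_conj_plaqU(')`: the two paths differ by a CONJUGATE of `plaqU` (`b⁻¹a = b⁻¹U(∂p)b`, resp. `U_μ(x)⁻¹U(∂p_{μν}(x))U_μ(x)`).
* §3 `R_sub_R_eq` (`R(a)X − R(b)X = R(b)(R(b⁻¹a)X − X)`); ★ `hs_R_sub_R_le_of_conj` (`HS ≤ 4ε²HS(X)` from `|U(∂p) − 1| ≤ ε`, via `B9Eq335PlaquetteAtLettersY.norm_conj_sub_one_le`
  and `B9Thm31SiteCoerciveGaugeBlockY.hs_R_sub_self_le`); ★★ `hs_cdS_cdS_sub_le`, ★★ `hs_cdsS_cdS_sub_le` — the `HS` sizes of the two commutators at a site under a POINTWISE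
  window `|plaqU μ ν z − 1| ≤ ε(z)`: `≤ 4ε(z)²·HS(w(z+e_μ+e_ν))`, resp. `≤ 4ε(z−e_ν)²·HS(g(z−e_ν+e_μ))`.
* §4 `plaqU_symm_eq_inv`, `plaqU_diag`, ★ `plaqU_eq_holY` (`plaqU (shiftY i) (UboxY i U) μ ν z = holY i U ⟨boxEquiv⁻¹z, μ, ν⟩` for `μ < ν`, by `Node00.OpsYGauge.boxEquiv_symm_shiftY`),
  ★★ `norm_plaqU_sub_one_le_of_holY`: a window `|holY U p − 1| ≤ ε(boxEquiv p.src)` on def-Y's plaquettes (what `B9Eq335PlaquetteAtLettersY.norm_holY_sub_one_le_of_reg335`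
  ∕ `…CoverageAtLettersY` ∕ `…CoveragePAtLettersY` deliver on the (3.35) class) is a window on ALL `plaqU μ ν z` (both orientations, the degenerate one trivially).
HONEST SCOPE: [folklore] lattice gauge algebra + norm bookkeeping at def-Y's letters; nothing of print's estimates asserted; NOT a node discharge, NOT summit progress;
count-neutral; nothing continuum ∕ OS ∕ mass gap ∕ Clay; the YM mass gap (Clay) is NOT proved by any of this — R4 closes the conditional finite-𝕋⁴ rung `BalabanLadder.UV`
only.  NEW file importing file 20 (`…GsqDecayReg335Y`, for the trace-pairing toolkit), `B9Eq335PlaquetteAtLettersY`, `Node00.OpsYGauge`, `B9Eq3104CommutatorGradFormDD`.  Net new unproved facts: 0.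
-/

noncomputable section

namespace Literature.MathematicalPhysics.QuantumFieldTheory.Balaban1983to89.B9Thm31SiteCurvatureCommutatorsY

open Literature.MathematicalPhysics.QuantumFieldTheory.Balaban1983to89
open Node00 B6KLevelCensusIndexV1 B6MultiLevelTorusOperator B6GlobalChartV1 B9BackgroundsKLevelV1
  B9Eq39Adjoint B9Thm311ReadingCoords B9Thm311DeltaPrimePos B9Ineq369CurvatureSmallAtLettersY B9Thm31SiteCoerciveGaugeBlockY B9Thm31SiteGpBoundsReg335Y
open Literature.MathematicalPhysics.QuantumFieldTheory.Balaban1983to89.B9Ineq349SiteAdjoint (trIP_comm trIP_cdS_left)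
open Literature.MathematicalPhysics.QuantumFieldTheory.Balaban1983to89.B9Eq3132CoerciveVariational (trIP_sub_right trIP_sub_left)
open scoped Matrix Matrix.Norms.L2Operator

variable {d ℓ : ℕ} {hd : 1 ≤ d + 1} {hL : Odd (ℓ + 1) ∧ 1 < ℓ + 1} {b₀ b₁ : ℝ}
variable (i : KIdx d ℓ hd hL b₀ b₁) {N : ℕ} {G : Subgroup (Matrix (Fin N) (Fin N) ℂ)ˣ}

section Shifts

/-! ## §1 The box-chart shifts commute -/

/-- the box-chart shifts commute: `τ_μ τ_ν = τ_ν τ_μ`. [cite: Balaban1985BackgroundPropagators, (3.4) p.391 (the plaquette `x, x+e_μ, x+e_μ+e_ν, x+e_ν`), bookkeeping] -/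
theorem shiftY_shiftY_comm (μ ν : Fin (d + 1)) (z : SiteY i) : shiftY i μ (shiftY i ν z) = shiftY i ν (shiftY i μ z) := by
  show tshift (toKT i).NB (unitVec μ) (tshift (toKT i).NB (unitVec ν) z) = tshift (toKT i).NB (unitVec ν) (tshift (toKT i).NB (unitVec μ) z)
  rw [tshift_tshift, tshift_tshift, add_comm (unitVec μ)]

end Shifts

section Commutators

/-! ## §2 The two curvature commutators as plaquette defects -/

variable {𝔸 : Type} [NormedRing 𝔸] [NormedAlgebra ℂ 𝔸] [CompleteSpace 𝔸]

/-- ★ **THE COMMUTATOR OF TWO FORWARD COVARIANT DIFFERENCES IS A PLAQUETTE DEFECT**: with `a = U_μ(z)U_ν(z+e_μ)`, `b = U_ν(z)U_μ(z+e_ν)` (the two paths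
around `p_{μν}(z)`, `ab⁻¹ = U(∂p)`), `(∇_μ∇_ν w − ∇_ν∇_μ w)(z) = R(a)w(z+e_μ+e_ν) − R(b)w(z+e_μ+e_ν)` — the lattice `[∇_μ, ∇_ν] = F_{μν}`.
[cite: Balaban1985BackgroundPropagators, (3.3)–(3.4) pp.390–391, (3.117) p.419] -/
theorem cdS_cdS_sub_apply (U : CfgY 𝔸 i) (μ ν : Fin (d + 1)) (w : SiteY i → 𝔸) (z : SiteY i) :
    cdS i U μ (cdS i U ν w) z - cdS i U ν (cdS i U μ w) z
      = R (UboxY i U μ z * UboxY i U ν (shiftY i μ z)) (w (shiftY i ν (shiftY i μ z)))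
        - R (UboxY i U ν z * UboxY i U μ (shiftY i ν z)) (w (shiftY i ν (shiftY i μ z))) := by
  simp only [cdS, covD, R_sub, B9Eq39Adjoint.R_mul, shiftY_shiftY_comm i μ ν z]
  abel

/-- ★ **THE COMMUTATOR OF A BACKWARD AND A FORWARD COVARIANT DIFFERENCE**: with `x = z − e_ν`, `a′ = U_ν(x)⁻¹U_μ(x)`, `b′ = U_μ(z)U_ν(x+e_μ)⁻¹`,
`(∇*_ν∇_μ g − ∇_μ∇*_ν g)(z) = R(a′)g(x+e_μ) − R(b′)g(x+e_μ)` (`b′⁻¹a′ = U_μ(x)⁻¹U(∂p_{μν}(x))U_μ(x)`).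
[cite: Balaban1985BackgroundPropagators, (3.3)–(3.8) pp.390–392, (3.117) p.419] -/
theorem cdsS_cdS_sub_apply (U : CfgY 𝔸 i) (μ ν : Fin (d + 1)) (g : SiteY i → 𝔸) (z : SiteY i) :
    cdsS i U ν (cdS i U μ g) z - cdS i U μ (cdsS i U ν g) z
      = R ((UboxY i U ν ((shiftY i ν).symm z))⁻¹ * UboxY i U μ ((shiftY i ν).symm z)) (g (shiftY i μ ((shiftY i ν).symm z)))
        - R (UboxY i U μ z * (UboxY i U ν ((shiftY i ν).symm (shiftY i μ z)))⁻¹) (g (shiftY i μ ((shiftY i ν).symm z))) := by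
  simp only [cdS, cdsS, covD, covDstar, R_sub, B9Eq39Adjoint.R_mul, B9Eq3104CommutatorGradFormDD.shiftY_symm_shiftY_comm i ν μ z]
  abel

/-- the two paths around a plaquette differ by the conjugated holonomy: `b⁻¹a = b⁻¹·U(∂p)·b` for `a = U_μ(z)U_ν(z+e_μ)`, `b = U_ν(z)U_μ(z+e_ν)`.
[cite: Balaban1985BackgroundPropagators, (3.1)–(3.4) pp.390–391, bookkeeping] -/
theorem paths_eq_conj_plaqU (U : CfgY 𝔸 i) (μ ν : Fin (d + 1)) (z : SiteY i) :
    (UboxY i U ν z * UboxY i U μ (shiftY i ν z))⁻¹ * (UboxY i U μ z * UboxY i U ν (shiftY i μ z))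
      = (UboxY i U ν z * UboxY i U μ (shiftY i ν z))⁻¹ * plaqU (shiftY i) (UboxY i U) μ ν z * (UboxY i U ν z * UboxY i U μ (shiftY i ν z)) := by
  simp only [plaqU, mul_inv_rev, mul_assoc, inv_mul_cancel_left, inv_mul_cancel, mul_one]

/-- the backward/forward pair likewise: `b′⁻¹a′ = U_μ(x)⁻¹·U(∂p_{μν}(x))·U_μ(x)`, `x = z − e_ν`. [cite: Balaban1985BackgroundPropagators, (3.1)–(3.8) pp.390–392, bookkeeping] -/
theorem paths_eq_conj_plaqU' (U : CfgY 𝔸 i) (μ ν : Fin (d + 1)) (x : SiteY i) :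
    (UboxY i U μ (shiftY i ν x) * (UboxY i U ν (shiftY i μ x))⁻¹)⁻¹ * ((UboxY i U ν x)⁻¹ * UboxY i U μ x)
      = (UboxY i U μ x)⁻¹ * plaqU (shiftY i) (UboxY i U) μ ν x * UboxY i U μ x := by
  simp only [plaqU, mul_inv_rev, inv_inv, mul_assoc, inv_mul_cancel_left]

end Commutators

section HS

/-! ## §3 `HS` sizes under a pointwise plaquette window -/

/-- `R(a)X − R(b)X = R(b)(R(b⁻¹a)X − X)`. [cite: Balaban1985BackgroundPropagators, (3.1) p.390, bookkeeping] -/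
theorem R_sub_R_eq (a b : (Matrix (Fin N) (Fin N) ℂ)ˣ) (X : Matrix (Fin N) (Fin N) ℂ) : R a X - R b X = R b (R (b⁻¹ * a) X - X) := by
  rw [R_sub, ← B9Eq39Adjoint.R_mul, mul_inv_cancel_left]

/-- ★ **THE `HS` SIZE OF A PATH DEFECT**: for `G`-valued transporters, `G ≤ U(N)`: `HS(R(a)X − R(b)X) ≤ 4ε²·HS(X)` whenever `b⁻¹a = g⁻¹U(∂p)g` with
`g ∈ G` and `|U(∂p) − 1| ≤ ε`. [cite: Balaban1985BackgroundPropagators, (3.35) p.396, (3.117) p.419] -/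
theorem hs_R_sub_R_le_of_conj (hG : G ≤ B7Prop2Explicit.unitaryUnits (Matrix (Fin N) (Fin N) ℂ)) {a b g P : (Matrix (Fin N) (Fin N) ℂ)ˣ}
    (ha : a ∈ G) (hb : b ∈ G) (hg : g ∈ G) (hab : b⁻¹ * a = g⁻¹ * P * g) {ε : ℝ} (hP : ‖(P : Matrix (Fin N) (Fin N) ℂ) - 1‖ ≤ ε)
    (X : Matrix (Fin N) (Fin N) ℂ) :
    ∑ r, ∑ s, ‖(R a X - R b X) r s‖ ^ 2 ≤ 4 * ε ^ 2 * ∑ r, ∑ s, ‖X r s‖ ^ 2 := by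
  have hbc := contractive_of_mem_unitary (V := b) (hG hb)
  have hgc := contractive_of_mem_unitary (V := g) (hG hg)
  have hcG : b⁻¹ * a ∈ G := G.mul_mem (G.inv_mem hb) ha
  have hcc := contractive_of_mem_unitary (V := b⁻¹ * a) (hG hcG)
  have hc : ‖(((b⁻¹ * a : (Matrix (Fin N) (Fin N) ℂ)ˣ)) : Matrix (Fin N) (Fin N) ℂ) - 1‖ ≤ ε := by
    rw [hab]; exact (B9Eq335PlaquetteAtLettersY.norm_conj_sub_one_le hgc P).trans hP
  rw [R_sub_R_eq, hs_R_eq_of_contraction hbc]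
  exact hs_R_sub_self_le hc hcc.2 X

/-- ★★ **`HS` OF THE COMMUTATOR `[∇_μ, ∇_ν]w` AT A SITE**: `≤ 4·|U(∂p_{μν}(z)) − 1|²·HS(w(z+e_μ+e_ν))` for a `G`-valued `U`, `G ≤ U(N)`.
[cite: Balaban1985BackgroundPropagators, (3.35) p.396, (3.117) p.419] -/
theorem hs_cdS_cdS_sub_le (hG : G ≤ B7Prop2Explicit.unitaryUnits (Matrix (Fin N) (Fin N) ℂ)) {U : CfgY (Matrix (Fin N) (Fin N) ℂ) i}
    (hU : ∀ μ x, U μ x ∈ G) {ε : SiteY i → ℝ} (hF : ∀ μ ν z, ‖((plaqU (shiftY i) (UboxY i U) μ ν z : (Matrix (Fin N) (Fin N) ℂ)ˣ) : Matrix (Fin N) (Fin N) ℂ) - 1‖ ≤ ε z)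
    (μ ν : Fin (d + 1)) (w : SiteY i → Matrix (Fin N) (Fin N) ℂ) (z : SiteY i) :
    ∑ r, ∑ s, ‖(cdS i U μ (cdS i U ν w) z - cdS i U ν (cdS i U μ w) z) r s‖ ^ 2
      ≤ 4 * ε z ^ 2 * ∑ r, ∑ s, ‖w (shiftY i ν (shiftY i μ z)) r s‖ ^ 2 := by
  have hUb : ∀ μ' (x : SiteY i), UboxY i U μ' x ∈ G := fun μ' x => hU μ' _
  rw [cdS_cdS_sub_apply]
  exact hs_R_sub_R_le_of_conj hG (G.mul_mem (hUb μ z) (hUb ν _)) (G.mul_mem (hUb ν z) (hUb μ _)) (G.mul_mem (hUb ν z) (hUb μ _))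
    (paths_eq_conj_plaqU i U μ ν z) (hF μ ν z) _

/-- ★★ **`HS` OF THE COMMUTATOR `[∇*_ν, ∇_μ]g` AT A SITE**: `≤ 4·|U(∂p_{μν}(z − e_ν)) − 1|²·HS(g(z − e_ν + e_μ))`.
[cite: Balaban1985BackgroundPropagators, (3.35) p.396, (3.117) p.419] -/
theorem hs_cdsS_cdS_sub_le (hG : G ≤ B7Prop2Explicit.unitaryUnits (Matrix (Fin N) (Fin N) ℂ)) {U : CfgY (Matrix (Fin N) (Fin N) ℂ) i}
    (hU : ∀ μ x, U μ x ∈ G) {ε : SiteY i → ℝ} (hF : ∀ μ ν z, ‖((plaqU (shiftY i) (UboxY i U) μ ν z : (Matrix (Fin N) (Fin N) ℂ)ˣ) : Matrix (Fin N) (Fin N) ℂ) - 1‖ ≤ ε z)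
    (μ ν : Fin (d + 1)) (g : SiteY i → Matrix (Fin N) (Fin N) ℂ) (z : SiteY i) :
    ∑ r, ∑ s, ‖(cdsS i U ν (cdS i U μ g) z - cdS i U μ (cdsS i U ν g) z) r s‖ ^ 2
      ≤ 4 * ε ((shiftY i ν).symm z) ^ 2 * ∑ r, ∑ s, ‖g (shiftY i μ ((shiftY i ν).symm z)) r s‖ ^ 2 := by
  have hUb : ∀ μ' (x : SiteY i), UboxY i U μ' x ∈ G := fun μ' x => hU μ' _
  obtain ⟨x, rfl⟩ : ∃ x, z = shiftY i ν x := ⟨(shiftY i ν).symm z, (Equiv.apply_symm_apply _ _).symm⟩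
  rw [cdsS_cdS_sub_apply]
  simp only [Equiv.symm_apply_apply, B9Eq3104CommutatorGradFormDD.shiftY_symm_shiftY_comm i ν μ]
  exact hs_R_sub_R_le_of_conj hG (G.mul_mem (G.inv_mem (hUb ν x)) (hUb μ x)) (G.mul_mem (hUb μ _) (G.inv_mem (hUb ν _))) (hUb μ x)
    (paths_eq_conj_plaqU' i U μ ν x) (hF μ ν x) _

end HS

section Bridge

/-! ## §4 From def-Y's holonomy to the box-chart plaquette variables -/

/-- swapping the directions inverts the plaquette variable: `U(∂p_{νμ}(x)) = U(∂p_{μν}(x))⁻¹` (the NE9 team's `B9Eq3117Current.plaqU_swap`, restated here only to keep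
the import closure light). [cite: Balaban1985BackgroundPropagators, (3.1) p.390, (3.7) p.391 («U(−∂p) = U(∂p)⁻¹»)] -/
theorem plaqU_symm_eq_inv {S 𝔸 : Type} [Ring 𝔸] {ι : Type} (T : ι → Equiv.Perm S) (V : ι → S → 𝔸ˣ) (μ ν : ι) (x : S) :
    plaqU T V ν μ x = (plaqU T V μ ν x)⁻¹ := by
  simp only [plaqU, mul_inv_rev, inv_inv, mul_assoc]

/-- the degenerate plaquette is trivial: `U(∂p_{μμ}(x)) = 1`. [cite: Balaban1985BackgroundPropagators, (3.1) p.390, bookkeeping] -/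
theorem plaqU_diag {S 𝔸 : Type} [Ring 𝔸] {ι : Type} (T : ι → Equiv.Perm S) (V : ι → S → 𝔸ˣ) (μ : ι) (x : S) :
    plaqU T V μ μ x = 1 := by
  simp only [plaqU, mul_inv_cancel_right, mul_inv_cancel]

/-- ★ **THE BOX-CHART PLAQUETTE VARIABLE IS def-Y's HOLONOMY**: for `μ < ν`, `plaqU (shiftY i) (UboxY i U) μ ν z = holY i U ⟨boxEquiv⁻¹ z, μ, ν⟩`
(`Node00.OpsYGauge.boxEquiv_symm_shiftY`). [cite: Balaban1985BackgroundPropagators, (3.1) p.390, dictionary] -/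
theorem plaqU_eq_holY {𝔸 : Type} [NormedRing 𝔸] [NormedAlgebra ℂ 𝔸] [CompleteSpace 𝔸] (U : CfgY 𝔸 i) {μ ν : Fin (d + 1)} (hμν : μ < ν) (z : SiteY i) :
    plaqU (shiftY i) (UboxY i U) μ ν z = holY i U ⟨(boxEquiv i.hN).symm z, μ, ν, hμν⟩ := by
  simp only [plaqU, holY, UboxY, boxEquiv_symm_shiftY]

/-- ★★ **A WINDOW ON def-Y's PLAQUETTE VARIABLES IS A WINDOW ON ALL BOX-CHART PLAQUETTE VARIABLES** (both orientations and the degenerate one): for a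
`G`-valued `U`, `G ≤ U(N)`, `|holY U p − 1| ≤ ε(boxEquiv p.src)` for every plaquette `p` and `ε ≥ 0` give `|plaqU μ ν z − 1| ≤ ε(z)` for ALL `μ, ν, z` — the
hypothesis `hF` of `bochner_le` in the shape (3.35)∕(3.69) is supplied at the letters of record (`B9Eq335PlaquetteAtLettersY.norm_holY_sub_one_le_of_reg335`,
`B9Eq335CoverageAtLettersY`, `…CoveragePAtLettersY`). [cite: Balaban1985BackgroundPropagators, (3.35) p.396, (3.69) p.404] -/
theorem norm_plaqU_sub_one_le_of_holY (hG : G ≤ B7Prop2Explicit.unitaryUnits (Matrix (Fin N) (Fin N) ℂ)) {U : CfgY (Matrix (Fin N) (Fin N) ℂ) i}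
    (hU : ∀ μ x, U μ x ∈ G) {ε : SiteY i → ℝ} (hε0 : ∀ z, 0 ≤ ε z)
    (hε : ∀ p : PlaqY i, ‖((holY i U p : (Matrix (Fin N) (Fin N) ℂ)ˣ) : Matrix (Fin N) (Fin N) ℂ) - 1‖ ≤ ε (boxEquiv i.hN p.src))
    (μ ν : Fin (d + 1)) (z : SiteY i) :
    ‖((plaqU (shiftY i) (UboxY i U) μ ν z : (Matrix (Fin N) (Fin N) ℂ)ˣ) : Matrix (Fin N) (Fin N) ℂ) - 1‖ ≤ ε z := by
  have hUb : ∀ μ' (x : SiteY i), UboxY i U μ' x ∈ G := fun μ' x => hU μ' _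
  have hPG : ∀ μ' ν', plaqU (shiftY i) (UboxY i U) μ' ν' z ∈ G := fun μ' ν' =>
    G.mul_mem (G.mul_mem (G.mul_mem (hUb _ _) (hUb _ _)) (G.inv_mem (hUb _ _))) (G.inv_mem (hUb _ _))
  have hlt : ∀ {μ' ν'}, μ' < ν' → ‖((plaqU (shiftY i) (UboxY i U) μ' ν' z : (Matrix (Fin N) (Fin N) ℂ)ˣ) : Matrix (Fin N) (Fin N) ℂ) - 1‖ ≤ ε z := by
    intro μ' ν' h
    have h1 := hε ⟨(boxEquiv i.hN).symm z, μ', ν', h⟩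
    rw [Equiv.apply_symm_apply] at h1
    rwa [plaqU_eq_holY i U h]
  rcases lt_trichotomy μ ν with h | h | h
  · exact hlt h
  · subst h
    rw [plaqU_diag, Units.val_one, sub_self, norm_zero]
    exact hε0 z
  · -- `U(∂p_{μν}) = U(∂p_{νμ})⁻¹` and `|P⁻¹ − 1| = |P⁻¹(1 − P)| ≤ |P − 1|`
    rw [plaqU_symm_eq_inv]
    set P := plaqU (shiftY i) (UboxY i U) ν μ z with hP
    have hPc := contractive_of_mem_unitary (V := P) (hG (hPG ν μ))
    have e : (((P⁻¹ : (Matrix (Fin N) (Fin N) ℂ)ˣ)) : Matrix (Fin N) (Fin N) ℂ) - 1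
        = ((P⁻¹ : (Matrix (Fin N) (Fin N) ℂ)ˣ) : Matrix (Fin N) (Fin N) ℂ) * (1 - (P : Matrix (Fin N) (Fin N) ℂ)) := by
      rw [mul_sub, mul_one, ← Units.val_mul, inv_mul_cancel, Units.val_one]
    rw [e]
    calc _ ≤ ‖((P⁻¹ : (Matrix (Fin N) (Fin N) ℂ)ˣ) : Matrix (Fin N) (Fin N) ℂ)‖ * ‖1 - (P : Matrix (Fin N) (Fin N) ℂ)‖ := norm_mul_le _ _
      _ ≤ 1 * ‖1 - (P : Matrix (Fin N) (Fin N) ℂ)‖ := mul_le_mul_of_nonneg_right hPc.2 (norm_nonneg _)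
      _ = ‖(P : Matrix (Fin N) (Fin N) ℂ) - 1‖ := by rw [one_mul, norm_sub_rev]
      _ ≤ ε z := hlt h

end Bridge

end Literature.MathematicalPhysics.QuantumFieldTheory.Balaban1983to89.B9Thm31SiteCurvatureCommutatorsY
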